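import Literature.MathematicalPhysics.PowerSystems.OscillatorNetworkTypeCounts
import HarnessLib

/-!
# The `(N − m, m)` antipodal cluster states of the all-to-all oscillator network are type-`m`
# saddles (first-order and swing models) — the identical-frequency fixed points of the complete
# network, read through Bronski–DeVille–Park's count (`κᵢ = ±(N − 2m)`, `τ = 1`)

Topic `Literature/MathematicalPhysics/PowerSystems`; namespaces `…NonuniformKuramoto`,
`…ClassicalModel.LosslessSystem`. A COROLLARY file: everything is PROVED from
`OscillatorNetworkTypeCounts.lean` (`complete_type_auxJac`, `complete_type_phaseJac`); 0 definitions,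
0 named facts, 0 `sorry`.

SOURCES. J. C. Bronski, L. DeVille, M. J. Park, Chaos 22 (2012) 033133 [BronskiDeVillePark2012]
§2.2 Def. 2.2 (`κᵢ = Σⱼ cos(θⱼ − θᵢ)`, `τ = Σ κᵢ⁻¹`), Prop. 2.1, **Theorem 2.2** (`n₊(J) = n₊(D) +
[τ > 2]` when all `κᵢ ≠ 0`, `τ ≠ 2`; arXiv:1111.5302 p0005 L150–p0006 L100). R. Taylor, J. Phys. A
45 (2012) [Taylor2012] §4.1 / Thm 4.1 (fixed points of the complete homogeneous network: clusters
at angle `0` and `π`, «the zero fixed point is stable … the only stable fixed point for the complete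
network»; arXiv:1109.4451 p0011). H.-D. Chiang et al. [Chiang1995] §6 Thm 6.1 / 6.7 (type).

THE STATES. For a subset `B` of the `N` nodes with `|B| = m`, `2m < N`, the configuration `θᵢ = π`
(`i ∈ B`), `θᵢ = 0` (`i ∉ B`) — a fixed point of every identical-frequency lossless network
(`twoCluster_sin_eq_zero`). On the uniform complete network: `κᵢ = N − 2m > 0` off `B`,
`κᵢ = 2m − N < 0` on `B` (`twoCluster_rowSum_cos`), so `#{κᵢ < 0} = m` and
`τ = (N − m)/(N − 2m) + m/(2m − N) = 1` (`twoCluster_counts`); BDP's count gives TYPE `m`.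

WHAT IS PROVED. `twoCluster_rowSum_cos`, `twoCluster_counts`, `twoCluster_sin_eq_zero`;
★★★ **`NonuniformKuramoto.complete_twoCluster_type_auxJac`** (uniform complete coupling `k > 0`, ANY
`Dᵢ > 0`: the Jacobian `−D⁻¹L(θ)` at the `(N − m, m)` state has exactly `m` roots in the open right
half-plane, `N − 1 − m` in the open left half-plane, one on the axis), ★★★ `classic_twoCluster_type_
auxJac` (classic model `K/N`), ★★★ **`ClassicalModel.LosslessSystem.complete_twoCluster_type_phaseJac`**
(swing model, `Mᵢ, Dᵢ > 0`: `m` RHP roots, `N − 1 − m + N` LHP, one on the axis).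

THREE COLUMNS. CERTIFIED: kernel theorems — the type of every antipodal two-cluster fixed point of
the uniform all-to-all network with `2m < N`, both model tiers. MODELLED: uniform complete lossless
coupling; identical natural frequencies for the fixed-point reading. NOT CLAIMED: the balanced case
`2m = N` (all `κᵢ = 0`, degenerate), incoherent fixed points with `r = 0` (`N ≥ 3`), non-complete
networks.
-/

noncomputable section

open Real Set Filter Topology Metric Finset Matrix
open scoped Matrix

namespace Literature.MathematicalPhysics.PowerSystems

namespace NonuniformKuramoto

variable {n : ℕ}

/-! ### §1. The `(N − m, m)` two-cluster (antipodal) states: row sums and `τ = 1` -/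

/-- Row sums of cosines at a two-cluster state `θᵢ ∈ {0, π}` with minority cluster `B` (`|B| = m`):
`κᵢ = N − 2m` off `B` and `κᵢ = 2m − N` on `B`. [cite: BronskiDeVillePark2012, §2.2 Definition 2.2 (`κᵢ = Σⱼ cos(θⱼ − θᵢ)`) applied to `θ ∈ {0, π}ᴺ`; Taylor2012, §4.1 (fixed points of the complete homogeneous network as clusters on the circle)] -/
theorem twoCluster_rowSum_cos (B : Finset (Fin n)) (θ : Fin n → ℝ)
    (hθ : ∀ i, θ i = if i ∈ B then Real.pi else 0) (i : Fin n) :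
    ∑ j, Real.cos (θ i - θ j)
      = if i ∈ B then (2 * (B.card : ℝ) - n) else ((n : ℝ) - 2 * B.card) := by
  classical
  have hcos : ∀ j, Real.cos (θ i - θ j) = if (i ∈ B ↔ j ∈ B) then 1 else -1 := by
    intro j
    rw [hθ i, hθ j]
    by_cases hi : i ∈ B <;> by_cases hj : j ∈ B <;> simp [hi, hj]
  simp only [hcos]
  have hsplit : ∑ j, (if (i ∈ B ↔ j ∈ B) then (1 : ℝ) else -1)
      = ∑ j ∈ B, (if (i ∈ B ↔ j ∈ B) then (1 : ℝ) else -1)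
        + ∑ j ∈ Bᶜ, (if (i ∈ B ↔ j ∈ B) then (1 : ℝ) else -1) := by
    rw [← Finset.sum_add_sum_compl B]
  rw [hsplit]
  have hcard : (Bᶜ.card : ℝ) = n - B.card := by
    rw [Finset.card_compl, Fintype.card_fin, Nat.cast_sub (B.card_le_univ.trans_eq (by simp))]
  by_cases hi : i ∈ B
  · have e1 : ∑ j ∈ B, (if (i ∈ B ↔ j ∈ B) then (1 : ℝ) else -1) = ∑ j ∈ B, (1 : ℝ) :=
      Finset.sum_congr rfl fun j hj => by rw [if_pos (iff_of_true hi hj)]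
    have e2 : ∑ j ∈ Bᶜ, (if (i ∈ B ↔ j ∈ B) then (1 : ℝ) else -1) = ∑ j ∈ Bᶜ, (-1 : ℝ) :=
      Finset.sum_congr rfl fun j hj => by rw [if_neg (fun h => (Finset.mem_compl.1 hj) (h.1 hi))]
    rw [if_pos hi, e1, e2, Finset.sum_const, Finset.sum_const, nsmul_eq_mul, nsmul_eq_mul, hcard]
    ring
  · have e1 : ∑ j ∈ B, (if (i ∈ B ↔ j ∈ B) then (1 : ℝ) else -1) = ∑ j ∈ B, (-1 : ℝ) :=
      Finset.sum_congr rfl fun j hj => by rw [if_neg (fun h => hi (h.2 hj))]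
    have e2 : ∑ j ∈ Bᶜ, (if (i ∈ B ↔ j ∈ B) then (1 : ℝ) else -1) = ∑ j ∈ Bᶜ, (1 : ℝ) :=
      Finset.sum_congr rfl fun j hj => by rw [if_pos (iff_of_false hi (Finset.mem_compl.1 hj))]
    rw [if_neg hi, e1, e2, Finset.sum_const, Finset.sum_const, nsmul_eq_mul, nsmul_eq_mul, hcard]
    ring

/-- At a two-cluster state with `2m < N`: all `κᵢ ≠ 0`, `#{κᵢ < 0} = m` and `τ = Σ 1/κᵢ = 1`.
[cite: BronskiDeVillePark2012, §2.2 Definition 2.2 / Theorem 2.2 (the quantities `n₊(D)`, `τ`)] -/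
theorem twoCluster_counts (B : Finset (Fin n)) (hm : 2 * B.card < n) (θ : Fin n → ℝ)
    (hθ : ∀ i, θ i = if i ∈ B then Real.pi else 0) :
    (∀ i, ∑ j, Real.cos (θ i - θ j) ≠ 0)
      ∧ (univ.filter fun i => ∑ j, Real.cos (θ i - θ j) < 0).card = B.card
      ∧ ∑ i, 1 / ∑ j, Real.cos (θ i - θ j) = 1 := by
  classical
  have hm' : (2 : ℝ) * B.card < n := by exact_mod_cast hm
  have hpos : 0 < (n : ℝ) - 2 * B.card := by linarith
  simp only [twoCluster_rowSum_cos B θ hθ]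
  refine ⟨fun i => ?_, ?_, ?_⟩
  · by_cases hi : i ∈ B
    · rw [if_pos hi]; linarith
    · rw [if_neg hi]; exact hpos.ne'
  · congr 1
    ext i
    simp only [Finset.mem_filter, Finset.mem_univ, true_and]
    by_cases hi : i ∈ B
    · rw [if_pos hi]; exact ⟨fun _ => hi, fun _ => by linarith⟩
    · rw [if_neg hi]; exact ⟨fun h => absurd h (not_lt.2 hpos.le), fun h => absurd h hi⟩
  · rw [← Finset.sum_add_sum_compl B]
    have e1 : ∑ i ∈ B, 1 / (if i ∈ B then (2 * (B.card : ℝ) - n) else ((n : ℝ) - 2 * B.card))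
        = ∑ i ∈ B, 1 / (2 * (B.card : ℝ) - n) :=
      Finset.sum_congr rfl fun i hi => by rw [if_pos hi]
    have e2 : ∑ i ∈ Bᶜ, 1 / (if i ∈ B then (2 * (B.card : ℝ) - n) else ((n : ℝ) - 2 * B.card))
        = ∑ i ∈ Bᶜ, 1 / ((n : ℝ) - 2 * B.card) :=
      Finset.sum_congr rfl fun i hi => by rw [if_neg (Finset.mem_compl.1 hi)]
    rw [e1, e2, Finset.sum_const, Finset.sum_const, nsmul_eq_mul, nsmul_eq_mul, Finset.card_compl,
      Fintype.card_fin, Nat.cast_sub (B.card_le_univ.trans_eq (by simp))]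
    have h2 : (n : ℝ) - 2 * B.card ≠ 0 := hpos.ne'
    have e : (2 * (B.card : ℝ) - n) = -((n : ℝ) - 2 * B.card) := by ring
    rw [e, one_div_neg_eq_neg_one_div]
    have e2 : (B.card : ℝ) * -(1 / ((n : ℝ) - 2 * B.card))
        + ((n : ℝ) - B.card) * (1 / ((n : ℝ) - 2 * B.card))
        = ((n : ℝ) - 2 * B.card) * (1 / ((n : ℝ) - 2 * B.card)) := by ring
    rw [e2, mul_one_div, div_self h2]

/-- A two-cluster state is a fixed point of every identical-frequency lossless network: all the
coupling terms `sin(θᵢ − θⱼ) ∈ {sin 0, sin(±π)}` vanish. [cite: Taylor2012, §4.1 («fixed points associated with … the complete network», clusters at angle `0` and `π`) (arXiv:1109.4451 p0011)] -/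
theorem twoCluster_sin_eq_zero (B : Finset (Fin n)) (θ : Fin n → ℝ)
    (hθ : ∀ i, θ i = if i ∈ B then Real.pi else 0) (i j : Fin n) : Real.sin (θ i - θ j) = 0 := by
  rw [hθ i, hθ j]
  by_cases hi : i ∈ B <;> by_cases hj : j ∈ B <;> simp [hi, hj]

variable (k : ℝ) (Kur : NonuniformKuramoto n)

/-- ★★★ **THE `(N − m, m)` ANTIPODAL CLUSTER STATE OF THE ALL-TO-ALL NETWORK IS A TYPE-`m` SADDLE.**
MODEL: first-order oscillators / droop units, uniform complete lossless coupling `k > 0`, ANY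
`Dᵢ > 0`; the configuration with the `m` units of `B` at phase `π` and the other `N − m` at phase
`0`, `2m < N` (a fixed point for identical natural frequencies). Its Jacobian `−D⁻¹L(θ)` has
exactly `m` characteristic roots in the open right half-plane, `N − 1 − m` in the open left
half-plane and one on the axis (`κᵢ = ±(N − 2m)`, `τ = 1`). In particular the in-phase state
(`m = 0`) is the only one of type `0`.
[cite: BronskiDeVillePark2012, §2.2 Theorem 2.2 with Proposition 2.1 (arXiv:1111.5302 p0005 L150–p0006 L100); Taylor2012, §4 Theorem 4.1 (the in-phase state is the only stable fixed point of the complete homogeneous network); Chiang1995, §6 Theorem 6.7 (R1)] -/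
theorem complete_twoCluster_type_auxJac (hD : ∀ i, 0 < Kur.D i) (hk : 0 < k)
    (hP : ∀ i j, Kur.P i j = if i = j then 0 else k) (B : Finset (Fin n)) (hm : 2 * B.card < n)
    (θ : Fin n → ℝ) (hθ : ∀ i, θ i = if i ∈ B then Real.pi else 0) :
    ((Kur.toDroopNetwork.auxJac θ).map (algebraMap ℝ ℂ)).charpoly.roots.countP (fun μ => 0 < μ.re)
        = B.card
      ∧ ((Kur.toDroopNetwork.auxJac θ).map (algebraMap ℝ ℂ)).charpoly.roots.countP (fun μ => μ.re < 0)
        = n - 1 - B.card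
      ∧ ((Kur.toDroopNetwork.auxJac θ).map (algebraMap ℝ ℂ)).charpoly.roots.countP (fun μ => μ.re = 0)
        = 1 := by
  obtain ⟨hκ, hcount, hτ⟩ := twoCluster_counts B hm θ hθ
  have hn : 0 < n := by omega
  obtain ⟨t1, t2, t3⟩ := Kur.complete_type_auxJac k hD hk hP hn θ hκ (by rw [hτ]; norm_num)
  rw [hcount, hτ] at t1 t2
  refine ⟨?_, ?_, t3⟩
  · rw [t1]; norm_num
  · rw [t2]; norm_num

/-- ★★★ **The same for the classic model** `θ̇ᵢ = ω − (K/N)Σⱼ sin(θᵢ − θⱼ)` (identical frequencies,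
`K > 0`): the `(N − m, m)` cluster state is a fixed point of type `m`.
[cite: BronskiDeVillePark2012, §2.2 Theorem 2.2; Taylor2012, §4 Theorem 4.1] -/
theorem classic_twoCluster_type_auxJac {Kc : ℝ} (hKc : 0 < Kc) (ω : Fin n → ℝ)
    (B : Finset (Fin n)) (hm : 2 * B.card < n)
    (θ : Fin n → ℝ) (hθ : ∀ i, θ i = if i ∈ B then Real.pi else 0) :
    (((classic n Kc ω).toDroopNetwork.auxJac θ).map (algebraMap ℝ ℂ)).charpoly.roots.countP
          (fun μ => 0 < μ.re) = B.card
      ∧ (((classic n Kc ω).toDroopNetwork.auxJac θ).map (algebraMap ℝ ℂ)).charpoly.roots.countP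
          (fun μ => μ.re < 0) = n - 1 - B.card
      ∧ (((classic n Kc ω).toDroopNetwork.auxJac θ).map (algebraMap ℝ ℂ)).charpoly.roots.countP
          (fun μ => μ.re = 0) = 1 := by
  have hn : 0 < n := by omega
  exact (classic n Kc ω).complete_twoCluster_type_auxJac (Kc / (n : ℝ)) (fun _ => one_pos)
    (div_pos hKc (Nat.cast_pos.2 hn)) (fun _ _ => rfl) B hm θ hθ

end NonuniformKuramoto

namespace ClassicalModel

namespace LosslessSystem

variable {n : ℕ} (S : LosslessSystem n 0) (k : ℝ)

/-- ★★★ **Swing model: the `(N − m, m)` cluster state of the uniform complete network is a type-`m`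
saddle `(θ, 0)`** — `m` roots of the swing Jacobian in the open right half-plane, `N − 1 − m + N`
in the open left half-plane, one on the axis (`Mᵢ, Dᵢ > 0`).
[cite: BronskiDeVillePark2012, §2.2 Theorem 2.2; Chiang1995, §6.3 Theorem 6.1; Taylor2012, §4 Theorem 4.1] -/
theorem complete_twoCluster_type_phaseJac (hk : 0 < k) (hC : ∀ i j, S.C i j = if i = j then 0 else k)
    (hM : ∀ i, 0 < S.M i) (hD : ∀ i, 0 < S.D i) (B : Finset (Fin n)) (hm : 2 * B.card < n)
    (θ : Fin n → ℝ) (hθ : ∀ i, θ i = if i ∈ B then Real.pi else 0) :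
    ((S.phaseJac θ).map (algebraMap ℝ ℂ)).charpoly.roots.countP (fun μ => 0 < μ.re) = B.card
      ∧ ((S.phaseJac θ).map (algebraMap ℝ ℂ)).charpoly.roots.countP (fun μ => μ.re < 0)
        = n - 1 - B.card + n
      ∧ ((S.phaseJac θ).map (algebraMap ℝ ℂ)).charpoly.roots.countP (fun μ => μ.re = 0) = 1 := by
  obtain ⟨hκ, hcount, hτ⟩ := NonuniformKuramoto.twoCluster_counts B hm θ hθ
  have hn : 0 < n := by omega
  obtain ⟨t1, t2, t3⟩ := S.complete_type_phaseJac k hk hC hM hD hn θ hκ (by rw [hτ]; norm_num)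
  rw [hcount, hτ] at t1 t2
  refine ⟨?_, ?_, t3⟩
  · rw [t1]; norm_num
  · rw [t2]; norm_num

end LosslessSystem

end ClassicalModel

end Literature.MathematicalPhysics.PowerSystems

end
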